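import Summits.QuantumFields.BalabanUV.T4Continuum.Support.BoundaryRateWeightedTilt
import Summits.QuantumFields.BalabanUV.T4Continuum.Support.BoundaryRateOpDisc
import Literature.MathematicalPhysics.QuantumFieldTheory.Balaban1983to89.T4EtaRateMin

/-!
# BoundaryRateOpDiscFrame — the ROUND-2 skeleton's composition C1 with the operator discrepancy PRODUCED, and the operator
η-rate split into its row-NE2 part and its row-NE3 part (`T4EtaRateMin.LocalRate` BY NAME) (cell `pub-balaban`, T⁴ fan-out,
`HOME/BINDER-OWNERS.md` row NE5, route P3 «boundary-functional member»; skeleton `t4/skeletons/NE5-t4-ne5-p3.md` v1.1 §7 row B5 ∕ leaf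
L11; lineage t4-ne5-p3 gen 17; bookkeeping only; imports the sibling cell modules `Support.BoundaryRateWeightedTilt` (p206967),
`Support.BoundaryRateOpDisc` (p206646) and the Literature leaf `T4EtaRateMin` (row NE3's typed shapes) ONLY, modifies nothing of them)

HONEST FRAMING (T4-DAG PAGE 1; identical to the parents').  The cell's T⁴ target is rung (B)+1: existence AND uniqueness of the
ε → 0 limit of Bałaban's unit-scale averaged loop expectations on a FIXED finite torus — strictly beyond ultraviolet stability,
NOT infinite volume, NOT a mass gap, NOT the Clay problem.  HONEST DEPENDENCY (cell line, verbatim): «continuum YM on T⁴ ⇐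
BetaPertH ∧ nine spine estimates (0/9 proved); BetaPertH ⇐ (D1) ∧ (D4) ∧ CAP+tail; G-an2-4 gates asym, D1 and NE2/3/4.»  This
module asserts NOTHING about Bałaban's objects; every `def … : Prop` is a parametrised HYPOTHESIS SHAPE over ABSTRACT carriers,
every theorem [folklore] bookkeeping.  `T4BoundaryCarrier.NE5B` is NOT PRINTED and NOT proved here; rows NE2 ∕ NE3's estimates are
NOT proved here (they enter as displayed binders, by name where the tree has the shape).

WHAT THIS MODULE DOES.  §1: the operator η-rate `BoundaryRateOpDisc.OpRate opA opB W dist r δ θ` of the boundary generation step FROM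
TWO PARTS through an INTERMEDIATE operator datum `opMid` (run A's operators at run B's transported internal configuration — the
analogue of route P1's minimiser split `OutputRateTowerSocket.operatorRate_of_towerLaw_split` ∕ liaison §4): the NE2-PART
`OpRate opA opMid W dist r δ₂ θ` (covariances ∕ propagators ∕ averaging kernels at two spacings read at ONE configuration — node
U1a's object, `T4EtaRate`, `CovariantAveragingTower.OneStepAveragedLaw`, `BackgroundResolventTower.PerturbationLaws`) and the
NE3-PART = [operator Lipschitz in the INTERNAL configuration, `OpLipBg` (printed CONTEXT: the step's operators are functions of the
background through the covariant Laplacian, [Balaban1985BackgroundPropagators] (3.23)–(3.24) p. 394; no modulus asserted)] × [the two runs' internal configurations'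
distance `m g X` DOMINATED by one site-reading discrepancy of a `T4EtaRateMin.Readings` carrier obeying row NE3's
`T4EtaRateMin.LocalRate R Cm θ`] — `opRate_of_parts`, `configDist_le_of_localRate`, `opRate_of_parts_localRate`
(`δ = δ₂ + Λb·Cm`), under a displayed triangle inequality of the step's gauge (`DistTriangle`).  §2: the skeleton's composition C1
`BoundaryRateWeightedTilt.ne5B_of_pathFrame₂` with its binder `hOD : OpDisc …` PRODUCED by `BoundaryRateOpDisc.opDisc_of_split`
(`ne5B_of_pathFrame_opSplit`, Cop = Λ·δ) and, further, with `OpRate` produced from the two parts (`ne5B_of_pathFrame_opParts`,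
Cop = Λ·(δ₂ + Λb·Cm)) — ONE END face in which the two-run binders are EXACTLY: the NE2-part rate `δ₂`, row NE3's `LocalRate`, the
admissibility `hadmA` of run A's transported tables, and the sibling members' rate `hE`; conclusion `T4BoundaryCarrier.NE5B` LITERALLY.
§3: non-vacuity of §1 on the chain of `BoundaryRateOpDisc` §3 (intermediate datum = run B's, NE3-part zero).
Names used — `BoundaryRateOpDisc`: `ReadsOpA`, `ReadsOpB`, `OpLip`, `OpRate`, `opDisc_of_split`, `chainOpA`, `chainOpB`, `chain_opRate`;
`BoundaryRateWeightedTilt`: `ne5B_of_pathFrame₂`; `T4BoundaryRate`: `Generation`, `FluctChart`, `TiltLip`, `RepresentsA/B`, `GenMap`, `BTable`,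
`ETable`, `pullB`, `epullB`, `tabB`, `etabB`, `SliceCountGrowing`, `EKernelContracts`, `chainCarriers`; `T4BoundaryRateCollar`: `CplxFrame`,
`FrameChart`, `FrameCore`, `FramePath`, `FrameAnalytic`, `LayerGauge`, `GapShape`, `CollarDecay`; `T4EtaRateMin`: `Readings`, `LocalRate`;
`T4BoundaryCarrier.NE5B`; `T4OutputRate.NE5`.  Cell record: skeleton §7 B5; liaison pattern `T4OperatorRateLiaison.minDist_of_localRate`.
-/

namespace Summit.QuantumFields.BalabanUV.T4Continuum.BoundaryRateOpDiscFrame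

open Finset
open Literature.MathematicalPhysics.QuantumFieldTheory.Balaban1983to89
open T4OutputRate T4BoundaryCarrier T4BoundaryRate T4BoundaryRateCollar T4EtaRateMin
open BoundaryRateOpDisc BoundaryRateWeightedTilt

variable {C : T4BoundaryCarrier.Carriers} {Op : Type}

/-! ## §1 The operator η-rate from its NE2-part and its NE3-part -/

/-- **BOOKKEEPING SHAPE `DistTriangle`**: the step's gauge on operator data obeys the triangle inequality at every piece (holds for
any gauge induced by a seminorm; displayed rather than baked into a metric structure on `Op`). [bookkeeping] -/
def DistTriangle (dist : C.Dom → Op → Op → ℝ) : Prop :=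
  ∀ (X : C.Dom) (q q' q'' : Op), dist X q q'' ≤ dist X q q' + dist X q' q''

/-- **HYPOTHESIS SHAPE `OpLipBg`** (the NE3-part's operator half; printed TYPE, one run, no modulus asserted): the intermediate datum
`opMid g X` (run A's operators at run B's transported internal configuration) and run B's datum differ, in the step's gauge and in
margin units, by at most `Λb` times the internal configurations' distance `m g X` — operator Lipschitz dependence on the background
(CONTEXT: the step's operators depend on the background through the covariant Laplace operator `Δ_U = D*_U D_U` of
[Balaban1985BackgroundPropagators] (3.23)–(3.24) p. 394; route P1 carries the same binder as `hLip` of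
`OutputRateTowerSocket.operatorRate_of_towerLaw_split`; asserted for nothing of Bałaban's). [bookkeeping]
[cite: Balaban1985BackgroundPropagators, (3.23)–(3.24) p.394] -/
def OpLipBg (opMid opB : (ℕ → ℝ) → C.Dom → Op) (W : Set (ℕ → ℝ)) (dist : C.Dom → Op → Op → ℝ) (r : C.Dom → ℝ)
    (Λb : ℝ) (m : (ℕ → ℝ) → C.Dom → ℝ) : Prop :=
  ∀ g ∈ W, ∀ X : C.Dom, dist X (opMid g X) (opB g X) ≤ Λb * m g X * r X

/-- **ROW NE3 BY NAME** [folklore]: if the internal configurations' distance at the piece `X` is dominated by ONE site-reading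
discrepancy `|R.loc (scale X + 1) V x − R.loc (scale X) V x|` of a `T4EtaRateMin.Readings` carrier obeying `LocalRate R Cm θ`, then
`m g X ≤ Cm·θ^{scale X}` (the liaison's `minDist_of_localRate`, indexed by pieces). -/
theorem configDist_le_of_localRate {ι Xs : Type*} (R : Readings ι Xs) {Cm θ : ℝ} (hR : LocalRate R Cm θ) {W : Set (ℕ → ℝ)}
    (m : (ℕ → ℝ) → C.Dom → ℝ)
    (hdom : ∀ g ∈ W, ∀ X : C.Dom, ∃ V ∈ R.dom, ∃ x : Xs, m g X ≤ |R.loc (C.scale X + 1) V x - R.loc (C.scale X) V x|) :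
    ∀ g ∈ W, ∀ X : C.Dom, m g X ≤ Cm * θ ^ C.scale X := by
  intro g hg X
  obtain ⟨V, hV, x, hx⟩ := hdom g hg X
  exact hx.trans (hR (C.scale X) V hV x)

/-- **`OpRate` FROM ITS TWO PARTS** [folklore]: NE2-part `δ₂` on the pair (run A, intermediate) + operator Lipschitz in the internal
configuration `Λb` × a configuration rate `m g X ≤ Cm·θ^{scale X}` ⟹ `OpRate opA opB … (δ₂ + Λb·Cm) θ` (triangle inequality). -/
theorem opRate_of_parts {opA opMid opB : (ℕ → ℝ) → C.Dom → Op} {W : Set (ℕ → ℝ)} {dist : C.Dom → Op → Op → ℝ}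
    {r : C.Dom → ℝ} {δ₂ θ Λb Cm : ℝ} {m : (ℕ → ℝ) → C.Dom → ℝ}
    (htri : DistTriangle dist) (h2 : OpRate opA opMid W dist r δ₂ θ) (hbg : OpLipBg opMid opB W dist r Λb m)
    (hm : ∀ g ∈ W, ∀ X : C.Dom, m g X ≤ Cm * θ ^ C.scale X) (hΛb : 0 ≤ Λb) (hr : ∀ X, 0 ≤ r X) :
    OpRate opA opB W dist r (δ₂ + Λb * Cm) θ := by
  intro g hg X
  have h3 : dist X (opMid g X) (opB g X) ≤ Λb * (Cm * θ ^ C.scale X) * r X :=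
    (hbg g hg X).trans (mul_le_mul_of_nonneg_right (mul_le_mul_of_nonneg_left (hm g hg X) hΛb) (hr X))
  calc dist X (opA g X) (opB g X) ≤ dist X (opA g X) (opMid g X) + dist X (opMid g X) (opB g X) := htri X _ _ _
    _ ≤ δ₂ * θ ^ C.scale X * r X + Λb * (Cm * θ ^ C.scale X) * r X := add_le_add (h2 g hg X) h3
    _ = (δ₂ + Λb * Cm) * θ ^ C.scale X * r X := by ring

/-- **`OpRate` = ROW NE2's PART ∧ ROW NE3's `LocalRate`, BOTH DISPLAYED** [folklore]: `opRate_of_parts` with the configuration rate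
supplied by `configDist_le_of_localRate`. -/
theorem opRate_of_parts_localRate {ι Xs : Type*} (R : Readings ι Xs) {opA opMid opB : (ℕ → ℝ) → C.Dom → Op}
    {W : Set (ℕ → ℝ)} {dist : C.Dom → Op → Op → ℝ} {r : C.Dom → ℝ} {δ₂ θ Λb Cm : ℝ} {m : (ℕ → ℝ) → C.Dom → ℝ}
    (htri : DistTriangle dist) (h2 : OpRate opA opMid W dist r δ₂ θ) (hbg : OpLipBg opMid opB W dist r Λb m)
    (hR : LocalRate R Cm θ)
    (hdom : ∀ g ∈ W, ∀ X : C.Dom, ∃ V ∈ R.dom, ∃ x : Xs, m g X ≤ |R.loc (C.scale X + 1) V x - R.loc (C.scale X) V x|)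
    (hΛb : 0 ≤ Λb) (hr : ∀ X, 0 ≤ r X) :
    OpRate opA opB W dist r (δ₂ + Λb * Cm) θ :=
  opRate_of_parts htri h2 hbg (configDist_le_of_localRate R hR m hdom) hΛb hr

/-! ## §2 The skeleton's composition C1 with `OpDisc` produced, and with `OpRate` produced from its two parts -/

section EndFaces

variable {A : Type} {E : Type*} [NormedAddCommGroup E] [NormedSpace ℂ E]

/-- **C1 WITH `OpDisc` PRODUCED** [folklore]: `BoundaryRateWeightedTilt.ne5B_of_pathFrame₂` with `hOD` := `BoundaryRateOpDisc.opDisc_of_split`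
(readings `ReadsOpA/B` + one-run operator modulus `OpLip Λ` + operator η-rate `OpRate δ` + reach) — `Cop = Λ·δ`; conclusion `NE5B` literally. -/
theorem ne5B_of_pathFrame_opSplit {F : CplxFrame C A E} {G : Generation C} {ch : FluctChart C A}
    {Ψ : Op → GenMap C C.BgB} {opA opB : (ℕ → ℝ) → C.Dom → Op} {ΦA : GenMap C C.BgA} {Φ : GenMap C C.BgB}
    {BA : BFunctional C C.BgA} {BB : BFunctional C C.BgB}
    {EA : Functional C.toCarriers C.BgA} {EB : Functional C.toCarriers C.BgB} {W : Set (ℕ → ℝ)}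
    {Adm : (ℕ → ℝ) → BTable C C.BgB → ETable C C.BgB → Prop} {AdmT : (ℕ → ℝ) → BTable C C.BgB → Prop}
    {lg : LayerGauge C} {gap : C.Dom → C.Dom → ℕ → ℝ} {dist : C.Dom → Op → Op → ℝ} {r : C.Dom → ℝ}
    {κ θ δ ρ kT g₀ ε Mc V Λ δo CE lamE : ℝ} {KT u : C.Dom → C.Dom → ℝ}
    (hRA : RepresentsA ΦA BA EA W) (hRB : RepresentsB Φ BB EB W)
    (hT : TiltLip G ch Φ W κ Adm KT)
    (hcl : ∀ g ∈ W, ∀ (f f' : BTable C C.BgB) (e e' : ETable C C.BgB), Adm g f e → Adm g f' e' → AdmT g (f - f'))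
    (hCh : FrameChart F ch) (hCo : FrameCore F ch) (hP : FramePath F G ch lg gap) (hAn : FrameAnalytic F W AdmT)
    (hGap : GapShape G gap g₀ ρ) (hCD : CollarDecay ch lg ε δ)
    (hKT0 : ∀ X Y, 0 ≤ KT X Y) (hKT : ∀ X : C.Dom, ∀ Y ∈ G.parents X, KT X Y ≤ kT * u X Y)
    (hROA : ReadsOpA Ψ opA ΦA BA EA W) (hROB : ReadsOpB Ψ opB Φ W Adm) (hL : OpLip Ψ W κ Adm dist r Λ)
    (hR : OpRate opA opB W dist r δo θ) (hr : ∀ X, 0 < r X) (hreach : ∀ X : C.Dom, δo * θ ^ C.scale X ≤ 1)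
    (hadmA : ∀ g ∈ W, Adm g (pullB BA g) (epullB EA g)) (hadmB : ∀ g ∈ W, Adm g (tabB BB g) (etabB EB g))
    (hS : SliceCountGrowing G κ u Mc V)
    (hKE : EKernelContracts G κ θ lamE) (hE : NE5 EA EB W κ θ CE)
    (hθ : 0 < θ) (hg₀ : 0 < g₀) (hρ : 0 ≤ ρ) (hε : 0 ≤ ε) (hδ : 0 ≤ δ) (hδ1 : δ ≤ 1) (hδρ : δ * ρ < 1)
    (h2ε : 2 * ε ≤ g₀) (hV : 0 ≤ V) (hδθ : δ * V < θ) (hkT : 0 ≤ kT) (hMc : 0 ≤ Mc)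
    (hsmall : kT * ((2 * ε / g₀) / (1 - δ * ρ)) * Mc * (δ * V / θ) / (1 - δ * V / θ) < 1)
    (hΛ : 0 ≤ Λ) (hδo : 0 ≤ δo) (hCE : 0 ≤ CE) (hlamE : 0 ≤ lamE) :
    NE5B BA BB W κ θ
      ((Λ * δo + lamE * CE) / (1 - kT * ((2 * ε / g₀) / (1 - δ * ρ)) * Mc * (δ * V / θ) / (1 - δ * V / θ))) :=
  ne5B_of_pathFrame₂ hRA hRB hT hcl hCh hCo hP hAn hGap hCD hKT0 hKT
    (opDisc_of_split hROA hROB hL hR hadmA hr hΛ hreach) hadmA hadmB hS hKE hE hθ hg₀ hρ hε hδ hδ1 hδρ h2ε hV hδθ hkT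
    hMc hsmall (mul_nonneg hΛ hδo) hCE hlamE

/-- **C1 WITH ROWS NE2 AND NE3 DISPLAYED SEPARATELY** [folklore]: the same with `OpRate` PRODUCED by `opRate_of_parts_localRate` — the
two-run binders of the boundary-member frame are then EXACTLY the NE2-part `h2 : OpRate opA opMid … δ₂ θ` (node U1a's object, read on
ONE configuration), row NE3's `hR3 : T4EtaRateMin.LocalRate R Cm θ` (node U1b) with the domination `hdom`, the admissibility `hadmA` of
run A's transported tables, and the sibling members' rate `hE`; `Cop = Λ·(δ₂ + Λb·Cm)`; conclusion `NE5B` literally. -/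
theorem ne5B_of_pathFrame_opParts {ιR Xs : Type*} (R : Readings ιR Xs) {F : CplxFrame C A E} {G : Generation C}
    {ch : FluctChart C A} {Ψ : Op → GenMap C C.BgB} {opA opMid opB : (ℕ → ℝ) → C.Dom → Op} {ΦA : GenMap C C.BgA}
    {Φ : GenMap C C.BgB} {BA : BFunctional C C.BgA} {BB : BFunctional C C.BgB}
    {EA : Functional C.toCarriers C.BgA} {EB : Functional C.toCarriers C.BgB} {W : Set (ℕ → ℝ)}
    {Adm : (ℕ → ℝ) → BTable C C.BgB → ETable C C.BgB → Prop} {AdmT : (ℕ → ℝ) → BTable C C.BgB → Prop}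
    {lg : LayerGauge C} {gap : C.Dom → C.Dom → ℕ → ℝ} {dist : C.Dom → Op → Op → ℝ} {r : C.Dom → ℝ}
    {m : (ℕ → ℝ) → C.Dom → ℝ}
    {κ θ δ ρ kT g₀ ε Mc V Λ δ₂ Λb Cm CE lamE : ℝ} {KT u : C.Dom → C.Dom → ℝ}
    (hRA : RepresentsA ΦA BA EA W) (hRB : RepresentsB Φ BB EB W)
    (hT : TiltLip G ch Φ W κ Adm KT)
    (hcl : ∀ g ∈ W, ∀ (f f' : BTable C C.BgB) (e e' : ETable C C.BgB), Adm g f e → Adm g f' e' → AdmT g (f - f'))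
    (hCh : FrameChart F ch) (hCo : FrameCore F ch) (hP : FramePath F G ch lg gap) (hAn : FrameAnalytic F W AdmT)
    (hGap : GapShape G gap g₀ ρ) (hCD : CollarDecay ch lg ε δ)
    (hKT0 : ∀ X Y, 0 ≤ KT X Y) (hKT : ∀ X : C.Dom, ∀ Y ∈ G.parents X, KT X Y ≤ kT * u X Y)
    (hROA : ReadsOpA Ψ opA ΦA BA EA W) (hROB : ReadsOpB Ψ opB Φ W Adm) (hL : OpLip Ψ W κ Adm dist r Λ)
    (htri : DistTriangle dist) (h2 : OpRate opA opMid W dist r δ₂ θ) (hbg : OpLipBg opMid opB W dist r Λb m)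
    (hR3 : LocalRate R Cm θ)
    (hdom : ∀ g ∈ W, ∀ X : C.Dom, ∃ V ∈ R.dom, ∃ x : Xs, m g X ≤ |R.loc (C.scale X + 1) V x - R.loc (C.scale X) V x|)
    (hr : ∀ X, 0 < r X) (hreach : ∀ X : C.Dom, (δ₂ + Λb * Cm) * θ ^ C.scale X ≤ 1)
    (hadmA : ∀ g ∈ W, Adm g (pullB BA g) (epullB EA g)) (hadmB : ∀ g ∈ W, Adm g (tabB BB g) (etabB EB g))
    (hS : SliceCountGrowing G κ u Mc V)
    (hKE : EKernelContracts G κ θ lamE) (hE : NE5 EA EB W κ θ CE)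
    (hθ : 0 < θ) (hg₀ : 0 < g₀) (hρ : 0 ≤ ρ) (hε : 0 ≤ ε) (hδ : 0 ≤ δ) (hδ1 : δ ≤ 1) (hδρ : δ * ρ < 1)
    (h2ε : 2 * ε ≤ g₀) (hV : 0 ≤ V) (hδθ : δ * V < θ) (hkT : 0 ≤ kT) (hMc : 0 ≤ Mc)
    (hsmall : kT * ((2 * ε / g₀) / (1 - δ * ρ)) * Mc * (δ * V / θ) / (1 - δ * V / θ) < 1)
    (hΛ : 0 ≤ Λ) (hδ₂ : 0 ≤ δ₂) (hΛb : 0 ≤ Λb) (hCm : 0 ≤ Cm) (hCE : 0 ≤ CE) (hlamE : 0 ≤ lamE) :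
    NE5B BA BB W κ θ
      ((Λ * (δ₂ + Λb * Cm) + lamE * CE) /
        (1 - kT * ((2 * ε / g₀) / (1 - δ * ρ)) * Mc * (δ * V / θ) / (1 - δ * V / θ))) :=
  ne5B_of_pathFrame_opSplit hRA hRB hT hcl hCh hCo hP hAn hGap hCD hKT0 hKT hROA hROB hL
    (opRate_of_parts_localRate R htri h2 hbg hR3 hdom hΛb (fun X => (hr X).le)) hr hreach hadmA hadmB hS hKE hE hθ hg₀ hρ
    hε hδ hδ1 hδρ h2ε hV hδθ hkT hMc hsmall hΛ (add_nonneg hδ₂ (mul_nonneg hΛb hCm)) hCE hlamE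

end EndFaces

/-! ## §3 Non-vacuity of §1 on the chain instance -/

/-- The absolute-value gauge on `ℝ` obeys the triangle inequality. [folklore] -/
theorem chain_distTriangle : DistTriangle (C := chainCarriers) (fun _ (q q' : ℝ) => |q - q'|) := by
  intro X q q' q''
  show |q - q''| ≤ |q - q'| + |q' - q''|
  exact abs_sub_le q q' q''

/-- On the chain of `BoundaryRateOpDisc` §3, with the intermediate datum := run B's datum, the NE3-part vanishes (`Λb = 0`, any `m`) and
`opRate_of_parts` recovers `chain_opRate` with `δ = 1 + 0·Cm` — §1 is realisable. [folklore] -/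
theorem chain_opRate_of_parts {θ : ℝ} (hθ : 0 ≤ θ) (W : Set (ℕ → ℝ)) {Cm : ℝ} (hCm : 0 ≤ Cm) :
    OpRate (C := chainCarriers) (chainOpA θ) chainOpB W (fun _ q q' => |q - q'|) (fun _ => 1) (1 + 0 * Cm) θ :=
  opRate_of_parts (opMid := chainOpB) (m := fun _ _ => 0) chain_distTriangle (chain_opRate hθ W)
    (fun g _ n => by simp [chainOpB]) (fun _ _ n => by positivity) le_rfl (fun _ => zero_le_one)

end Summit.QuantumFields.BalabanUV.T4Continuum.BoundaryRateOpDiscFrame
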